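import Summits.QuantumFields.BalabanUV.T4Continuum.Spine.NE2BalabanGauge
import Summits.QuantumFields.BalabanUV.T4Continuum.Support.GaugeTermInstance

/-!
# T⁴ programme, spine node NE2 (U1a), tier B row B7 (ASSEMBLY) — ROOT B WITH THE GAUGE SLOT DISCHARGED FROM ROW B4.b's END
# ON BAŁABAN's DATA: every B4 binder is now a law of the SCALAR TOWER (rows B4.d / B4.e) or a displayed number

NE2 formalisation swarm `b2b-balaban-t4-ne2-formalise-*`, leaf prover 08 (row B7 of `t4/formal/NE2/LEAVES.md`, CLAIMS l.5490), PART 2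
file 4.  Companion of `Spine/NE2BalabanLayer` (`perturbationLaws_tierB`), `Spine/NE2BalabanRoot` (`perturbationLaws_balaban`,
`balaban_rate_of_small`, `Kstar`), `Spine/NE2BalabanGauge` (`gaugeSlot`, `GeomNumbers`, `EGT_le_geom`, `liftR`) and of leaf-05's END of
row B4.b `Support/GaugeTermInstance` (`perturbationLaws_gaugeTerm_balaban`).

WHAT THIS FILE DOES (bookkeeping, model level).  Row B4.b's END `GaugeTermInstance.perturbationLaws_gaugeTerm_balaban` gives the target
shape for the gauge term `D_UP(U)D_U* − (∂P∂*) ⊗ 1` of the typed `Δ_a(U)` ([B9] (3.26) p.395, (3.25) p.394 shapes) with Bałaban's block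
averagings `QuT L M o T` / `Q1 L M o` and planting `J0 L M o`, from the scalar tower's `FreeTowerLaws` (row B4.d) and
`PerturbationLaws` (row B4.e), the connection / transporter sizes and the small-field inequality `σ₀⁻²·δK < 1`, with the consistency
datum `EGT … (esS κs e₁ e₂) (ecS κs e₀) (thetaS …) δT …`.  §1 turns GEOMETRIC bounds on the scalar tower's defects `e₀, e₁, e₂` and on
the transporters' two-level consistency `δT` (ratio `L⁻¹`, displayed constants `C₀ C₁ C₂ CT`) into `NE2BalabanGauge.GeomNumbers` of the
composite numbers (`geomNumbers_scalar`, constants `CesS`, `CecS`, `CthS`); §2 is the gauge slot in the target shape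
(`perturbationLaws_gaugeSlot_balaban`: `κ₄ = kappa4S d a a′ κs α τ`, `C₄ = C4S …`); §3 plugs it into `perturbationLaws_balaban`
(`perturbationLaws_balaban_closure`) and reads off ROOT B at `t = 1` under the explicit threshold (`balaban_closure_rate_of_small`).

BINDERS LEFT (all displayed, all data shapes of the rows; NOTHING is asserted): `hreg` (the (3.35) regularity class of the lifted
site transporters `liftR L M Rg`, row B5, c3), `hNE3 : LocalRate (bgReadings (regClass …)) C L⁻¹` (node NE3 BY NAME, c2/c7), `hE` (the
transport-error laws of `Ecov`, rows B3.a′ (iii) / B3.b-conc (iii) — open), `hfreeS` / `hpertS` (the scalar tower's laws, rows B4.d /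
B4.e), the sizes `α β β′ τ`, the geometric bounds `he₀ he₁ he₂ hδT`, and `σ₀⁻²·δK < 1`.  The smallness binder `hCη : C ≤ η` of the
`t = 1` face is IDLE (leaf-03, CLAIMS 07:02Z; removed by `Spine/NE2BalabanLayerSharp` when it lands) — kept here verbatim from
`NE2BalabanRoot.balaban_rate_of_small`.

HONEST FRAMING (T4-DAG p. 1).  Re-assembly BY NAME at MODEL LEVEL: the transporters, site transporters and the scalar tower's laws are
DATA / HYPOTHESES in the tree's shapes; no assertion that they are Bałaban's minimisers `U_k(V)` (no B0, c5); GLOBAL small field;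
finite torus, linear layer, operator norm.  ROOT B stays CONDITIONAL as displayed; NOT [B9] (3.23)–(3.26) as printed; NE2 (U1a) is NOT
PROVED by this file (c1 with the carver); spine PROVED count 0/9 unchanged; NOT infinite volume / mass gap / Clay.  HONEST DEPENDENCY:
continuum YM on T⁴ ⇐ BetaPertH ∧ nine spine estimates (0/9 proved); BetaPertH ⇐ (D1) ∧ (D4) ∧ CAP+tail; G-an2-4 gates asym, D1 and
NE2/3/4.  ABSOLUTE RULE: no internally-minted statement enters as a cited fact; every `[cite:]` tag below is a SHAPE locator; no
`def … : Prop` fact; no `sorry`.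
-/

noncomputable section

open scoped BigOperators ComplexConjugate Matrix Matrix.Norms.L2Operator Kronecker
open Filter Topology

namespace Summit.QuantumFields.BalabanUV.T4Continuum.NE2BalabanClosure

open Literature.MathematicalPhysics.QuantumFieldTheory.Balaban1983to89.B5Prop11Plancherel (Cst Cst_nonneg Tor fine)
open Literature.MathematicalPhysics.QuantumFieldTheory.Balaban1983to89.B5G183RateUnitTower (lev lev_neZero)
open Literature.MathematicalPhysics.QuantumFieldTheory.Balaban1983to89.T4EtaRateMin (LocalRate)
open Summit.QuantumFields.BalabanUV.T4Continuum
open Summit.QuantumFields.BalabanUV.T4Continuum.CovariantAveragingTower (TowerLimitRate)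
open Summit.QuantumFields.BalabanUV.T4Continuum.BalabanAveragedTowerUnit (idx Qlev cast_lev')
open Summit.QuantumFields.BalabanUV.T4Continuum.BackgroundResolventTower
open Summit.QuantumFields.BalabanUV.T4Continuum.KingPairingPlantedLaw
open Summit.QuantumFields.BalabanUV.T4Continuum.PerturbationAlgebra
open Summit.QuantumFields.BalabanUV.T4Continuum.GramPerturbationLaw (AveragingLaws C2gram)
open Summit.QuantumFields.BalabanUV.T4Continuum.NE2FromNE3 (bgReadings)
open Summit.QuantumFields.BalabanUV.T4Continuum.RegularBackgroundTower (RegularTransporters regClass)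
open Summit.QuantumFields.BalabanUV.T4Continuum.CovariantBlockAveraging (Ecov)
open Summit.QuantumFields.BalabanUV.T4Continuum.CovariantAveragingSummand (kappaQ)
open Summit.QuantumFields.BalabanUV.T4Continuum.BlockMultiplication (siteMul)
open Summit.QuantumFields.BalabanUV.T4Continuum.BlockPairingGeometry (tau parT)
open Summit.QuantumFields.BalabanUV.T4Continuum.BalabanAveragedTowerModes (par)
open Summit.QuantumFields.BalabanUV.T4Continuum.GaugeTermDecomposition (connL)
open Summit.QuantumFields.BalabanUV.T4Continuum.GaugeTermSandwichLaw
open Summit.QuantumFields.BalabanUV.T4Continuum.GaugeTermLayer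
open Summit.QuantumFields.BalabanUV.T4Continuum.GaugeTermPerturbationLaw
open Summit.QuantumFields.BalabanUV.T4Continuum.GaugeTermScalarData (QuT Q1 J0)
open Summit.QuantumFields.BalabanUV.T4Continuum.GaugeTermInstance (esS ecS thetaS perturbationLaws_gaugeTerm_balaban)
open Summit.QuantumFields.BalabanUV.T4Continuum.ScalarAveragedPropagator (DeltaPs gammaPs gammaPs_pos)
open Summit.QuantumFields.BalabanUV.T4Continuum.ScalarAveragedCompression (sigma0)
open Summit.QuantumFields.BalabanUV.T4Continuum.ScalarCovariantLaplacian (scalarPert)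
open Summit.QuantumFields.BalabanUV.T4Continuum.NE2BalabanLayer
open Summit.QuantumFields.BalabanUV.T4Continuum.NE2BalabanRoot
open Summit.QuantumFields.BalabanUV.T4Continuum.NE2BalabanGauge

/-! ## §1 Geometric numbers of the scalar data -/

section Geom

variable {d : ℕ} (L : ℕ) (a : ℝ)

/-- the constant of the composite injected number `esS`: `(C₁ + C₂)(1 − κs)⁻²`. [folklore] -/
def CesS (κs C₁ C₂ : ℝ) : ℝ := (C₁ + C₂) * ((1 - κs)⁻¹) ^ 2

/-- the constant of the composite complement number `ecS`: `(1 − κs)⁻¹·C₀`. [folklore] -/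
def CecS (κs C₀ : ℝ) : ℝ := (1 - κs)⁻¹ * C₀

/-- the constant of the planting number `thetaS`: `Cec·d(L+1)Cst + g·d(β′ + 2(α+β))Cst`. [folklore] -/
def CthS (d L : ℕ) (a g α β β' Cec : ℝ) : ℝ :=
  Cec * (d * ((L : ℝ) + 1) * Cst d a) + g * (d * ((β' + 2 * (α + β)) * Cst d a))

/-- the planting number with `n_k = L^k` substituted: its second term is EXACTLY geometric. [folklore] -/
theorem thetaS_eq (g α β β' : ℝ) (ec : ℕ → ℝ) (k : ℕ) :
    thetaS d L a g α β β' ec k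
      = ec k * (d * ((L : ℝ) + 1) * Cst d a) + g * (d * ((β' + 2 * (α + β)) * Cst d a)) * ((L : ℝ)⁻¹) ^ k := by
  unfold thetaS
  rw [cast_lev' L k, div_eq_mul_inv, ← inv_pow]
  ring

/-- **GEOMETRIC SCALAR DATA ⟹ `GeomNumbers` OF THE COMPOSITE NUMBERS.**  Nonnegative defects `e₀, e₁, e₂` and consistency `δT` bounded by
`C·L^{−k}` give `NE2BalabanGauge.GeomNumbers` for `(esS κs e₁ e₂, ecS κs e₀, thetaS …, δT)` with the displayed constants (`κs < 1`).
[folklore] -/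
theorem geomNumbers_scalar {κs g α β β' : ℝ} (hκ : κs < 1) {e₀ e₁ e₂ δT : ℕ → ℝ} {C₀ C₁ C₂ CT : ℝ}
    (he₀0 : ∀ k, 0 ≤ e₀ k) (he₁0 : ∀ k, 0 ≤ e₁ k) (he₂0 : ∀ k, 0 ≤ e₂ k) (hδT0 : ∀ k, 0 ≤ δT k)
    (he₀ : ∀ k, e₀ k ≤ C₀ * ((L : ℝ)⁻¹) ^ k) (he₁ : ∀ k, e₁ k ≤ C₁ * ((L : ℝ)⁻¹) ^ k) (he₂ : ∀ k, e₂ k ≤ C₂ * ((L : ℝ)⁻¹) ^ k)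
    (hδT : ∀ k, δT k ≤ CT * ((L : ℝ)⁻¹) ^ k) :
    GeomNumbers L (esS κs e₁ e₂) (ecS κs e₀) (thetaS d L a g α β β' (ecS κs e₀)) δT
      (CesS κs C₁ C₂) (CecS κs C₀) (CthS d L a g α β β' (CecS κs C₀)) CT := by
  have hν : 0 ≤ (1 - κs)⁻¹ := inv_nonneg.mpr (by linarith)
  have hA : 0 ≤ (d : ℝ) * ((L : ℝ) + 1) * Cst d a := by
    have := Cst_nonneg d a
    positivity
  have hec : ∀ k, ecS κs e₀ k ≤ CecS κs C₀ * ((L : ℝ)⁻¹) ^ k := fun k => by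
    unfold ecS CecS
    calc (1 - κs)⁻¹ * e₀ k ≤ (1 - κs)⁻¹ * (C₀ * ((L : ℝ)⁻¹) ^ k) := mul_le_mul_of_nonneg_left (he₀ k) hν
      _ = _ := by ring
  refine ⟨?_, ?_, hδT0, ?_, hec, ?_, hδT⟩
  · intro k
    unfold esS
    exact mul_nonneg (add_nonneg (he₁0 k) (he₂0 k)) (sq_nonneg _)
  · intro k
    unfold ecS
    exact mul_nonneg hν (he₀0 k)
  · intro k
    unfold esS CesS
    calc (e₁ k + e₂ k) * ((1 - κs)⁻¹) ^ 2 ≤ (C₁ * ((L : ℝ)⁻¹) ^ k + C₂ * ((L : ℝ)⁻¹) ^ k) * ((1 - κs)⁻¹) ^ 2 :=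
        mul_le_mul_of_nonneg_right (add_le_add (he₁ k) (he₂ k)) (sq_nonneg _)
      _ = _ := by ring
  · intro k
    rw [thetaS_eq]
    unfold CthS
    calc ecS κs e₀ k * (d * ((L : ℝ) + 1) * Cst d a) + g * (d * ((β' + 2 * (α + β)) * Cst d a)) * ((L : ℝ)⁻¹) ^ k
        ≤ CecS κs C₀ * ((L : ℝ)⁻¹) ^ k * (d * ((L : ℝ) + 1) * Cst d a)
          + g * (d * ((β' + 2 * (α + β)) * Cst d a)) * ((L : ℝ)⁻¹) ^ k :=
        add_le_add (mul_le_mul_of_nonneg_right (hec k) hA) le_rfl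
      _ = _ := by ring

end Geom

/-! ## §2 The gauge slot in the target shape, from row B4.b's END on Bałaban's data -/

variable {d : ℕ} (L : ℕ) [NeZero L] (M : Fin d → ℕ) [hM : ∀ μ, NeZero (M μ)] (a : ℝ) (ha : 0 < a)
variable {o : Type*} [Fintype o] [DecidableEq o]

/-- the resolvent size of the scalar family: `g = γ′⁻¹(1 − κs)⁻¹`. [folklore] -/
abbrev gS (d : ℕ) (a' κs : ℝ) : ℝ := (gammaPs d a')⁻¹ * (1 - κs)⁻¹

/-- the `U = 1` unit datum's size: `n₁ = σ₀⁻²`. [folklore] -/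
abbrev nS (d : ℕ) (a' : ℝ) : ℝ := ((sigma0 d a') ^ 2)⁻¹

/-- **`κ₄` OF THE GAUGE SLOT ON BAŁABAN's DATA**: `kappaGT d a g (1+τ) (dα) τ a′ n₁` at `g = γ′⁻¹(1−κs)⁻¹`, `n₁ = σ₀⁻²`. [folklore] -/
def kappa4S (d : ℕ) (a a' κs α τ : ℝ) : ℝ := kappaGT d a (gS d a' κs) (1 + τ) (d * α) τ a' (nS d a')

/-- **`C₄` OF THE GAUGE SLOT ON BAŁABAN's DATA**: `C4GT` at the composite geometric constants of both families (the free family has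
`e₂ = 0`). [folklore] -/
def C4S (d L : ℕ) (a a' κs α β β' τ C₀ C₁ C₂ CT : ℝ) : ℝ :=
  C4GT d a (gS d a' κs) (1 + τ) (d * α) τ a' (nS d a')
    (CesS κs C₁ C₂) (CecS κs C₀) (CthS d L a (gS d a' κs) α β β' (CecS κs C₀)) CT
    (CesS κs C₁ 0) (CecS κs C₀) (CthS d L a (gS d a' κs) α β β' (CecS κs C₀)) CT

/-- **THE GAUGE SLOT `P₄ = −(D_UP(U)D_U* − (∂P∂*) ⊗ 1)` IN THE TARGET SHAPE, FROM ROW B4.b's END ON BAŁABAN's DATA** (leaf-05's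
`GaugeTermInstance.perturbationLaws_gaugeTerm_balaban`, BY NAME) and geometric scalar data: `PerturbationLaws (Δ_a ⊗ 1) P₄ (J ⊗ 1) κ₄
(C₄·L^{−k})` with `κ₄ = kappa4S …`, `C₄ = C4S …`.  Binders: the scalar tower's `FreeTowerLaws` (row B4.d) and `PerturbationLaws` (row
B4.e), the sizes, the geometric bounds, `σ₀⁻²·δK < 1` — all displayed. [cite: Balaban1985BackgroundPropagators, (3.25) p.394, (3.26) p.395
(shapes)] [folklore] -/
theorem perturbationLaws_gaugeSlot_balaban (hd : 1 ≤ d) {Rg : (k : ℕ) → Fin d → (Tor (fine (lev L k) M) → Matrix o o ℂ)}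
    {T : (k : ℕ) → Tor (fine (lev L k) M) → Matrix o o ℂ} {a' : ℝ} (ha' : 0 < a')
    {A : (k : ℕ) → Matrix (Tor (fine (lev L k) M) × o) (Tor (fine (lev L (k + 1)) M) × o) ℂ}
    {F : (k : ℕ) → Matrix (Tor (fine (lev L k) M) × o) (Tor (fine (lev L k) M) × o) ℂ} {r : ℝ} {e₀ e₁ f e₂ δT : ℕ → ℝ}
    {κs α β β' τ : ℝ}
    (hfreeS : FreeTowerLaws (fun k => DeltaPs (lev L k) M a' ⊗ₖ (1 : Matrix o o ℂ)) A (J0 L M o) F r e₀ e₁ f)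
    (hpertS : PerturbationLaws (fun k => DeltaPs (lev L k) M a' ⊗ₖ (1 : Matrix o o ℂ))
      (fun k => scalarPert (lev L k) M a' (Rg k) (T k)) (J0 L M o) κs e₂)
    (hκ : κs < 1) (hα : 0 ≤ α) (hβ : 0 ≤ β) (hβ' : 0 ≤ β') (hτ : 0 ≤ τ)
    (hR : ∀ k μ i, ‖connL (fine (lev L k) M) (cl L k) (Rg k) μ i‖ ≤ α)
    (hLip : ∀ k μ lam i, ‖connL (fine (lev L k) M) (cl L k) (Rg k) μ (tau (fine (lev L k) M) lam i)
      - connL (fine (lev L k) M) (cl L k) (Rg k) μ i‖ ≤ β / (lev L k : ℕ))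
    (hcons : ∀ k μ (i' : Tor (fine (lev L (k + 1)) M) × Fin d),
      ‖connL (fine (lev L (k + 1)) M) (cl L (k + 1)) (Rg (k + 1)) μ i'
        - connL (fine (lev L k) M) (cl L k) (Rg k) μ (parT (lev L k) L M i')‖ ≤ β' / (lev L k : ℕ))
    (hT : ∀ k, ‖siteMul (T k) - 1‖ ≤ τ)
    (hTc : ∀ k, ‖siteMul (T (k + 1)) - siteMul (fun x' : Tor (fine (lev L (k + 1)) M) => T k (par (lev L k) L M x'))‖ ≤ δT k)
    (hsmall : nS d a' * deltaK (gS d a' κs) (1 + τ) (d * α) τ a' < 1)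
    {C₀ C₁ C₂ CT : ℝ} (he₀ : ∀ k, e₀ k ≤ C₀ * ((L : ℝ)⁻¹) ^ k) (he₁ : ∀ k, e₁ k ≤ C₁ * ((L : ℝ)⁻¹) ^ k)
    (he₂ : ∀ k, e₂ k ≤ C₂ * ((L : ℝ)⁻¹) ^ k) (hδT : ∀ k, δT k ≤ CT * ((L : ℝ)⁻¹) ^ k) :
    PerturbationLaws (fun k => calDalev L M a ha k ⊗ₖ (1 : Matrix o o ℂ)) (gaugeSlot L M Rg (QuT L M o T) (Q1 L M o) a')
      (fun k => JpcT L M k ⊗ₖ (1 : Matrix o o ℂ)) (kappa4S d a a' κs α τ)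
      (fun k => C4S d L a a' κs α β β' τ C₀ C₁ C₂ CT * ((L : ℝ)⁻¹) ^ k) := by
  have hL1 : 1 ≤ L := Nat.pos_of_ne_zero (NeZero.ne L)
  have h4 := perturbationLaws_gaugeTerm_balaban L M a ha Rg T a' ha' hd hfreeS hpertS hκ hα hβ hβ' hτ hR hLip hcons hT hTc hsmall
  have he₀0 : ∀ k, 0 ≤ e₀ k := fun k => (norm_nonneg _).trans (hfreeS.complement_le k)
  have he₁0 : ∀ k, 0 ≤ e₁ k := fun k => (norm_nonneg _).trans (hfreeS.injected_le k)
  have he₂0 : ∀ k, 0 ≤ e₂ k := fun k => (norm_nonneg _).trans (hpertS.consistent_le k)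
  have hδT0 : ∀ k, 0 ≤ δT k := fun k => (norm_nonneg _).trans (hTc k)
  have hGu := geomNumbers_scalar L a (d := d) (g := gS d a' κs) (α := α) (β := β) (β' := β') hκ he₀0 he₁0 he₂0 hδT0 he₀ he₁ he₂ hδT
  have hG₁ := geomNumbers_scalar L a (d := d) (g := gS d a' κs) (α := α) (β := β) (β' := β') (e₂ := fun _ => 0) (C₂ := 0) hκ
    he₀0 he₁0 (fun _ => le_rfl) hδT0 he₀ he₁ (fun k => by rw [zero_mul]) hδT
  have hν : 0 ≤ (1 - κs)⁻¹ := inv_nonneg.mpr (by linarith)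
  have hg : 0 ≤ gS d a' κs := mul_nonneg (inv_nonneg.mpr (gammaPs_pos (d := d) (a' := a')).1.le) hν
  have hn0 : 0 ≤ nS d a' := inv_nonneg.mpr (sq_nonneg _)
  have hn : 0 ≤ nS d a' * (1 - nS d a' * deltaK (gS d a' κs) (1 + τ) (d * α) τ a')⁻¹ :=
    mul_nonneg hn0 (inv_nonneg.mpr (by linarith))
  have hq : (0 : ℝ) ≤ 1 + τ := by linarith
  exact perturbationLaws_neg (perturbationLaws_mono h4 le_rfl
    (EGT_le_geom hL1 hq hg (mul_nonneg (Nat.cast_nonneg d) hα) hn hGu hG₁))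

/-! ## §3 ROOT B with the gauge slot discharged -/

/-- **`perturbationLaws_balaban` WITH THE GAUGE SLOT DISCHARGED FROM ROW B4.b's END** — the target shape for Bałaban's typed operator
`Δ_a(U) = Δ_a ⊗ 1 + [covariant Laplacian − Laplacian ⊗ 1] + a·n_k^d·[Q(U)ᴴQ(U) − (QᴴQ) ⊗ 1] − [gauge term]` on ONE site-based background
`Rg` (lifted to 1-forms by `liftR`), site transporters `T`, mass `a′`: `κ_B = kappaB o d a α₅ β₅ C (kappaQ d a a ε) (kappa4S …)`,
`C₂^B = C2B … (a·C2gram …) (C4S …)`.  Binders (displayed, data shapes of the rows): `hreg` (B5, c3), `hNE3` (NE3 BY NAME, c2/c7), `hE`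
(rows B3.a′ (iii)/B3.b-conc (iii), open), `hfreeS` (B4.d), `hpertS` (B4.e), sizes, geometric bounds, `σ₀⁻²·δK < 1` (c4).  NE2 is NOT
proved by this. [cite: Balaban1985BackgroundPropagators, (3.26) p.395 (shape)] [folklore] -/
theorem perturbationLaws_balaban_closure (hd : 1 ≤ d) {Rg : (k : ℕ) → Fin d → (Tor (fine (lev L k) M) → Matrix o o ℂ)}
    {α₅ β₅ : ℝ} (hreg : RegularTransporters L M (liftR L M Rg) α₅ β₅) {C : ℝ} (hC : 0 ≤ C)
    (hNE3 : LocalRate (bgReadings L M (regClass L M (liftR L M Rg))) C ((L : ℝ)⁻¹)) {ε Cδ : ℝ} (hε : 0 ≤ ε)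
    (hE : AveragingLaws (fun k => calDalev L M a ha k ⊗ₖ (1 : Matrix o o ℂ)) (Ecov L M (liftR L M Rg))
      (fun k => JpcT L M k ⊗ₖ (1 : Matrix o o ℂ)) ε (fun k => Cδ * ((L : ℝ)⁻¹) ^ k))
    {T : (k : ℕ) → Tor (fine (lev L k) M) → Matrix o o ℂ} {a' : ℝ} (ha' : 0 < a')
    {A : (k : ℕ) → Matrix (Tor (fine (lev L k) M) × o) (Tor (fine (lev L (k + 1)) M) × o) ℂ}
    {F : (k : ℕ) → Matrix (Tor (fine (lev L k) M) × o) (Tor (fine (lev L k) M) × o) ℂ} {r : ℝ} {e₀ e₁ f e₂ δT : ℕ → ℝ}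
    {κs α β β' τ : ℝ}
    (hfreeS : FreeTowerLaws (fun k => DeltaPs (lev L k) M a' ⊗ₖ (1 : Matrix o o ℂ)) A (J0 L M o) F r e₀ e₁ f)
    (hpertS : PerturbationLaws (fun k => DeltaPs (lev L k) M a' ⊗ₖ (1 : Matrix o o ℂ))
      (fun k => scalarPert (lev L k) M a' (Rg k) (T k)) (J0 L M o) κs e₂)
    (hκ : κs < 1) (hα : 0 ≤ α) (hβ : 0 ≤ β) (hβ' : 0 ≤ β') (hτ : 0 ≤ τ)
    (hR : ∀ k μ i, ‖connL (fine (lev L k) M) (cl L k) (Rg k) μ i‖ ≤ α)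
    (hLip : ∀ k μ lam i, ‖connL (fine (lev L k) M) (cl L k) (Rg k) μ (tau (fine (lev L k) M) lam i)
      - connL (fine (lev L k) M) (cl L k) (Rg k) μ i‖ ≤ β / (lev L k : ℕ))
    (hcons : ∀ k μ (i' : Tor (fine (lev L (k + 1)) M) × Fin d),
      ‖connL (fine (lev L (k + 1)) M) (cl L (k + 1)) (Rg (k + 1)) μ i'
        - connL (fine (lev L k) M) (cl L k) (Rg k) μ (parT (lev L k) L M i')‖ ≤ β' / (lev L k : ℕ))
    (hT : ∀ k, ‖siteMul (T k) - 1‖ ≤ τ)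
    (hTc : ∀ k, ‖siteMul (T (k + 1)) - siteMul (fun x' : Tor (fine (lev L (k + 1)) M) => T k (par (lev L k) L M x'))‖ ≤ δT k)
    (hsmall : nS d a' * deltaK (gS d a' κs) (1 + τ) (d * α) τ a' < 1)
    {C₀ C₁ C₂ CT : ℝ} (he₀ : ∀ k, e₀ k ≤ C₀ * ((L : ℝ)⁻¹) ^ k) (he₁ : ∀ k, e₁ k ≤ C₁ * ((L : ℝ)⁻¹) ^ k)
    (he₂ : ∀ k, e₂ k ≤ C₂ * ((L : ℝ)⁻¹) ^ k) (hδT : ∀ k, δT k ≤ CT * ((L : ℝ)⁻¹) ^ k) :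
    PerturbationLaws (fun k => calDalev L M a ha k ⊗ₖ (1 : Matrix o o ℂ))
      (balabanPert L M a (liftR L M Rg) (gaugeSlot L M Rg (QuT L M o T) (Q1 L M o) a'))
      (fun k => JpcT L M k ⊗ₖ (1 : Matrix o o ℂ)) (kappaB o d a α₅ β₅ C (kappaQ d a (a : ℂ) ε) (kappa4S d a a' κs α τ))
      (fun k => C2B o d L a α₅ β₅ C (a * C2gram (Cst d a) 1 ε (2 * d * Cst d a) (CJ d a) (Cst d a) Cδ)
        (C4S d L a a' κs α β β' τ C₀ C₁ C₂ CT) * ((L : ℝ)⁻¹) ^ k) :=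
  perturbationLaws_balaban L M a ha hd hreg hC hNE3 hε hE
    (perturbationLaws_gaugeSlot_balaban L M a ha hd ha' hfreeS hpertS hκ hα hβ hβ' hτ hR hLip hcons hT hTc hsmall he₀ he₁ he₂ hδT)

/-- **ROOT B AT `t = 1` FOR BAŁABAN's TYPED OPERATOR WITH THE GAUGE SLOT DISCHARGED, EXPLICIT THRESHOLD** (`L ≥ 2`, `d ≥ 1`): all
smallness data `α₅, β₅, C, ε, κ₄ ≤ η ≤ 1` (`κ₄ = kappa4S d a a′ κs α τ`) and `η·K⋆(card o, d, a) < 1` ⟹ the lifted King-averaged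
unit-lattice covariances of `(Δ_a^{(k)} ⊗ 1 + P_k)⁻¹` CONVERGE with rate `L^{−k}` — CONDITIONAL on node NE3, the regularity class,
Ecov's laws and the scalar tower's laws, all displayed (`hCη` idle, see the module docstring).  NE2 is NOT proved by this. [folklore] -/
theorem balaban_closure_rate_of_small (hL : 2 ≤ L) (hd : 1 ≤ d)
    {Rg : (k : ℕ) → Fin d → (Tor (fine (lev L k) M) → Matrix o o ℂ)}
    {α₅ β₅ : ℝ} (hreg : RegularTransporters L M (liftR L M Rg) α₅ β₅) {C : ℝ} (hC : 0 ≤ C)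
    (hNE3 : LocalRate (bgReadings L M (regClass L M (liftR L M Rg))) C ((L : ℝ)⁻¹)) {ε Cδ : ℝ} (hε : 0 ≤ ε)
    (hE : AveragingLaws (fun k => calDalev L M a ha k ⊗ₖ (1 : Matrix o o ℂ)) (Ecov L M (liftR L M Rg))
      (fun k => JpcT L M k ⊗ₖ (1 : Matrix o o ℂ)) ε (fun k => Cδ * ((L : ℝ)⁻¹) ^ k))
    {T : (k : ℕ) → Tor (fine (lev L k) M) → Matrix o o ℂ} {a' : ℝ} (ha' : 0 < a')
    {A : (k : ℕ) → Matrix (Tor (fine (lev L k) M) × o) (Tor (fine (lev L (k + 1)) M) × o) ℂ}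
    {F : (k : ℕ) → Matrix (Tor (fine (lev L k) M) × o) (Tor (fine (lev L k) M) × o) ℂ} {r : ℝ} {e₀ e₁ f e₂ δT : ℕ → ℝ}
    {κs α β β' τ : ℝ}
    (hfreeS : FreeTowerLaws (fun k => DeltaPs (lev L k) M a' ⊗ₖ (1 : Matrix o o ℂ)) A (J0 L M o) F r e₀ e₁ f)
    (hpertS : PerturbationLaws (fun k => DeltaPs (lev L k) M a' ⊗ₖ (1 : Matrix o o ℂ))
      (fun k => scalarPert (lev L k) M a' (Rg k) (T k)) (J0 L M o) κs e₂)
    (hκ : κs < 1) (hα : 0 ≤ α) (hβ : 0 ≤ β) (hβ' : 0 ≤ β') (hτ : 0 ≤ τ)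
    (hR : ∀ k μ i, ‖connL (fine (lev L k) M) (cl L k) (Rg k) μ i‖ ≤ α)
    (hLip : ∀ k μ lam i, ‖connL (fine (lev L k) M) (cl L k) (Rg k) μ (tau (fine (lev L k) M) lam i)
      - connL (fine (lev L k) M) (cl L k) (Rg k) μ i‖ ≤ β / (lev L k : ℕ))
    (hcons : ∀ k μ (i' : Tor (fine (lev L (k + 1)) M) × Fin d),
      ‖connL (fine (lev L (k + 1)) M) (cl L (k + 1)) (Rg (k + 1)) μ i'
        - connL (fine (lev L k) M) (cl L k) (Rg k) μ (parT (lev L k) L M i')‖ ≤ β' / (lev L k : ℕ))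
    (hT : ∀ k, ‖siteMul (T k) - 1‖ ≤ τ)
    (hTc : ∀ k, ‖siteMul (T (k + 1)) - siteMul (fun x' : Tor (fine (lev L (k + 1)) M) => T k (par (lev L k) L M x'))‖ ≤ δT k)
    (hsmall : nS d a' * deltaK (gS d a' κs) (1 + τ) (d * α) τ a' < 1)
    {C₀ C₁ C₂ CT : ℝ} (he₀ : ∀ k, e₀ k ≤ C₀ * ((L : ℝ)⁻¹) ^ k) (he₁ : ∀ k, e₁ k ≤ C₁ * ((L : ℝ)⁻¹) ^ k)
    (he₂ : ∀ k, e₂ k ≤ C₂ * ((L : ℝ)⁻¹) ^ k) (hδT : ∀ k, δT k ≤ CT * ((L : ℝ)⁻¹) ^ k)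
    {η : ℝ} (hαη : α₅ ≤ η) (hβη : β₅ ≤ η) (hCη : C ≤ η) (hεη : ε ≤ η) (hκη : kappa4S d a a' κs α τ ≤ η) (hη1 : η ≤ 1)
    (hηK : η * Kstar o d a < 1) :
    TowerLimitRate (fun k => Qlev L M k ⊗ₖ (1 : Matrix o o ℂ)) ((L : ℝ) ^ d)
      (fun k => (calDalev L M a ha k ⊗ₖ (1 : Matrix o o ℂ)
        + balabanPert L M a (liftR L M Rg) (gaugeSlot L M Rg (QuT L M o T) (Q1 L M o) a') k)⁻¹)
      (Cpert (kappaB o d a α₅ β₅ C (a * (ε * (2 + ε) * Cst d a)) (kappa4S d a a' κs α τ)) (2 * d * Cst d a) (CJ d a)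
        (C2B o d L a α₅ β₅ C (a * C2gram (Cst d a) 1 ε (2 * d * Cst d a) (CJ d a) (Cst d a) Cδ)
          (C4S d L a a' κs α β β' τ C₀ C₁ C₂ CT)) 0 1) ((L : ℝ)⁻¹) :=
  balaban_rate_of_small L M a ha hL hd hreg hC hNE3 hε hE
    (perturbationLaws_gaugeSlot_balaban L M a ha hd ha' hfreeS hpertS hκ hα hβ hβ' hτ hR hLip hcons hT hTc hsmall he₀ he₁ he₂ hδT)
    hαη hβη hCη hεη hκη hη1 hηK

end Summit.QuantumFields.BalabanUV.T4Continuum.NE2BalabanClosure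

end
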